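import Summits.Schanuel.Schanuel.Theorems.RootDecomp1HGaugeCore

/-!
# RootDecomp1H — ROUND 9 «GAUGE», part 2 of 2 (§3 the gauge family and its top end, §4 span-optimal presentations, §5 the W₄ half-rung)

Both parts (`RootDecomp1HGaugeCore` §1–§2, `RootDecomp1HGauge` §3–§5) share the namespace
`Summit.Schanuel.Schanuel.Theorems.RootDecomp1HGauge`; importers use `RootDecomp1HGauge`.
See part 1 (`RootDecomp1HGaugeCore`) for the account of the round. lens-5 cell decomp-schanuel g9; `--supports stmt-Schanuel-30564`.
-/

set_option linter.dupNamespace false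

noncomputable section

namespace Summit.Schanuel.Schanuel.Theorems.RootDecomp1HGauge

open Complex Set
open Literature.NumberTheory.Transcendental (SchanuelRank Khovanskii.ePD)
open Summit.Schanuel.Schanuel.Theses.RootDecomp1H
open Summit.Schanuel.Schanuel.Theorems.RootDecomp1HClearance (LowerRanks CounterEx InTowerHull)
open Summit.Schanuel.Schanuel.Theorems.RootDecomp1HStarLocalisation (starLocalisation_holds)
open Summit.Schanuel.Schanuel.Theorems.RootDecomp1HWitness

variable {n : ℕ}

/-! ## 3. The gauge family: the live items are the members `g n c = c + 3`; the top end is a theorem -/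

/-- «`y` is PRESENTED at size `c`»: a rational Khovanskii system of size `≤ c` vanishes at `(y, e^y)` with non-zero
exponential Jacobian, inside the ball `‖y‖ ≤ 4^c` (verbatim the inner clause of the first inline hypothesis of the items). -/
def Presented (n c : ℕ) (y : Fin n → ℂ) : Prop :=
  (∃ g : Fin n → MvPolynomial (Fin n ⊕ Fin n) ℚ, (∀ i, max (g i).totalDegree ((g i).support.sup fun m => max ((g i).coeff m).num.natAbs ((g i).coeff m).den) ≤ c) ∧ (∀ i, MvPolynomial.aeval (Sum.elim y (Complex.exp ∘ y)) (g i) = 0) ∧ (Matrix.of fun i j => MvPolynomial.aeval (Sum.elim y (Complex.exp ∘ y)) (Literature.NumberTheory.Transcendental.Khovanskii.ePD j (g i))).det ≠ 0) ∧ ‖y‖ ≤ ((4 ^ c : ℕ) : ℝ)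

/-- «near-`c⋆`-optimal»: presented at `c`, and no tuple with the same span is presented below `c` (verbatim the first inline
hypothesis of `BridgeTransverse` / `FinCS`). -/
def NearOpt (n c : ℕ) (y : Fin n → ℂ) : Prop :=
  Presented n c y ∧ ∀ c' < c, ¬ (∃ y' : Fin n → ℂ, Submodule.span ℚ (Set.range y) = Submodule.span ℚ (Set.range y') ∧ Presented n c' y')

/-- «conjugation-stable span» (verbatim the second inline hypothesis of the items). -/
def ConjStable (y : Fin n → ℂ) : Prop := ∀ j, (starRingEnd ℂ) (y j) ∈ Submodule.span ℚ (Set.range y)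

/-- THE BRIDGE AT GAUGE `g`: the text of `BridgeTransverse` with the size bound `c + 3` replaced by `g n c`. -/
def BridgeAt (g : ℕ → ℕ → ℕ) : Prop :=
  ∀ (n c : ℕ), LowerRanks n → ∀ y : Fin n → ℂ, NearOpt n c y → ConjStable y → CounterEx y → ¬ InTowerHull y →
    ∃ P : Fin (n + 1) → MvPolynomial (Fin n ⊕ Fin n) ℤ, (∀ i, psize (P i) ≤ g n c) ∧ IsCertificate n y P

/-- THE INSTRUMENT AT GAUGE `g`: the text of `FinCS` with the size bound `c + 3` replaced by `g n c`. -/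
def FinCSAt (g : ℕ → ℕ → ℕ) : Prop :=
  ∀ (n c : ℕ), LowerRanks n → ∀ y : Fin n → ℂ, NearOpt n c y → ConjStable y →
    (¬ LinearIndependent ℚ y ∨ ¬ (∃ P : Fin (n + 1) → MvPolynomial (Fin n ⊕ Fin n) ℤ, (∀ i, psize (P i) ≤ g n c) ∧ IsCertificate n y P))

/-- THE BRIDGE AT THE TOP GAUGE (no size bound). -/
def BridgeTop : Prop :=
  ∀ (n c : ℕ), LowerRanks n → ∀ y : Fin n → ℂ, NearOpt n c y → ConjStable y → CounterEx y → ¬ InTowerHull y →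
    ∃ P : Fin (n + 1) → MvPolynomial (Fin n ⊕ Fin n) ℤ, IsCertificate n y P

/-- THE INSTRUMENT AT THE TOP GAUGE (no size bound): a near-`c⋆`-optimal conjugation-stable presented tuple is `ℚ`-dependent or
carries NO transverse integer certificate at all. -/
def FinCSTop : Prop :=
  ∀ (n c : ℕ), LowerRanks n → ∀ y : Fin n → ℂ, NearOpt n c y → ConjStable y →
    (¬ LinearIndependent ℚ y ∨ ¬ (∃ P : Fin (n + 1) → MvPolynomial (Fin n ⊕ Fin n) ℤ, IsCertificate n y P))

/-- The live gauge `(n, c) ↦ c + 3`. -/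
def stdGauge : ℕ → ℕ → ℕ := fun _ c => c + 3

/-- **The live residual is the member `c + 3` of the family** (definitional). -/
theorem bridgeAt_std_iff : BridgeAt stdGauge ↔ BridgeTransverse := Iff.rfl

/-- **The live instrument is the member `c + 3` of the family** (definitional). -/
theorem finCSAt_std_iff : FinCSAt stdGauge ↔ FinCS := Iff.rfl

/-- The bridge is MONOTONE in the gauge. -/
theorem bridgeAt_mono {g g' : ℕ → ℕ → ℕ} (hgg : ∀ n c, g n c ≤ g' n c) (h : BridgeAt g) : BridgeAt g' :=
  fun n c hlow y hopt hcs hce hnh =>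
    let ⟨P, hP, hc⟩ := h n c hlow y hopt hcs hce hnh
    ⟨P, fun i => (hP i).trans (hgg n c), hc⟩

/-- The instrument is ANTITONE in the gauge. -/
theorem finCSAt_anti {g g' : ℕ → ℕ → ℕ} (hgg : ∀ n c, g n c ≤ g' n c) (h : FinCSAt g') : FinCSAt g :=
  fun n c hlow y hopt hcs => (h n c hlow y hopt hcs).imp_right fun hno ⟨P, hP, hc⟩ =>
    hno ⟨P, fun i => (hP i).trans (hgg n c), hc⟩

/-- Every member of the family implies the top bridge … -/
theorem bridgeTop_of_bridgeAt {g : ℕ → ℕ → ℕ} (h : BridgeAt g) : BridgeTop :=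
  fun n c hlow y hopt hcs hce hnh => let ⟨P, _, hc⟩ := h n c hlow y hopt hcs hce hnh; ⟨P, hc⟩

/-- … and the top instrument implies every member. -/
theorem finCSAt_of_finCSTop {g : ℕ → ℕ → ℕ} (h : FinCSTop) : FinCSAt g :=
  fun n c hlow y hopt hcs => (h n c hlow y hopt hcs).imp_right fun hno ⟨P, _, hc⟩ => hno ⟨P, hc⟩

/-- **THE TOP BRIDGE IS A THEOREM** (by §2; of its eight hypotheses only `trdeg ℚ(y, e^y) < n` is used). -/
theorem bridgeTop_holds : BridgeTop :=
  fun _ _ _ _ _ _ hce _ => exists_certificate_of_counterEx hce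

/-- **THE COSTUME END.** At the top gauge the route `closes` from the instrument alone (with `FirstFailureConjStable` and the
proved `StarLocalisation`): `FinCSTop` carries Schanuel's conjecture on the conjugation-stable cells by itself. -/
theorem closes_top (h₁ : FirstFailureConjStable) (h₂ : FinCSTop) : _root_.Schanuel := by
  show ∀ n, SchanuelRank n
  intro n
  induction n using Nat.strong_induction_on with
  | _ n ih =>
    intro x hli
    by_contra hlt
    rw [not_le] at hlt
    obtain ⟨c, y, hy, hycs, hopt⟩ := starLocalisation_holds n x ⟨ih, hli, hlt⟩ (h₁ n x ⟨ih, hli, hlt⟩)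
    rcases h₂ n c hy.1 y hopt hycs with hdep | hfree
    · exact hdep hy.2.1
    · exact hfree (exists_certificate_of_trdeg_lt hy.2.2)

/-- The GAUGE BOUND at `g`: at every transverse conjugation-stable near-`c⋆`-optimal first failure of cell `(n, c)` the
certificate gauge is at most `g n c`. -/
def GaugeBound (g : ℕ → ℕ → ℕ) : Prop :=
  ∀ (n c : ℕ), LowerRanks n → ∀ y : Fin n → ℂ, NearOpt n c y → ConjStable y → CounterEx y → ¬ InTowerHull y →
    certGauge n y ≤ g n c

/-- **THE BRIDGE IS A GAUGE INEQUALITY**: `BridgeAt g ↔ GaugeBound g` (uses §2: at a counterexample the gauge is attained). -/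
theorem bridgeAt_iff_gauge (g : ℕ → ℕ → ℕ) : BridgeAt g ↔ GaugeBound g := by
  constructor
  · intro h n c hlow y hopt hcs hce hnh
    obtain ⟨P, hP, hc⟩ := h n c hlow y hopt hcs hce hnh
    exact certGauge_le hc hP
  · intro h n c hlow y hopt hcs hce hnh
    obtain ⟨P, hP, hc⟩ := certGauge_spec_of_counterEx hce
    exact ⟨P, fun i => (hP i).trans (h n c hlow y hopt hcs hce hnh), hc⟩

/-- **THE RESIDUAL, RE-READ**: `BridgeTransverse` says exactly that the certificate gauge of every transverse conjugation-stable
near-`c⋆`-optimal first failure of cell `(n, c)` is at most `c + 3` — `N(y) ≤ c⋆(y) + 3`. -/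
theorem bridgeTransverse_iff_gauge : BridgeTransverse ↔ GaugeBound stdGauge :=
  bridgeAt_std_iff.symm.trans (bridgeAt_iff_gauge stdGauge)

/-- **THE INSTRUMENT, RE-READ**: `FinCSAt g` says that on the conjugation-stable near-`c⋆`-optimal cell `(n, c)` every `ℚ`-free
tuple carrying a certificate at all has certificate gauge `> g n c`. -/
theorem finCSAt_iff_gauge (g : ℕ → ℕ → ℕ) : FinCSAt g ↔
    ∀ (n c : ℕ), LowerRanks n → ∀ y : Fin n → ℂ, NearOpt n c y → ConjStable y → LinearIndependent ℚ y →
      (∃ P, IsCertificate n y P) → g n c < certGauge n y := by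
  constructor
  · intro h n c hlow y hopt hcs hli hex
    rcases h n c hlow y hopt hcs with hdep | hno
    · exact absurd hli hdep
    · by_contra hle
      obtain ⟨P, hP, hc⟩ := certGauge_spec hex
      exact hno ⟨P, fun i => (hP i).trans (not_lt.1 hle), hc⟩
  · intro h n c hlow y hopt hcs
    by_cases hli : LinearIndependent ℚ y
    · refine Or.inr fun ⟨P, hP, hc⟩ => ?_
      have hlt := h n c hlow y hopt hcs hli ⟨P, hc⟩
      exact absurd (certGauge_le hc hP) (not_le.2 hlt)
    · exact Or.inl hli

/-- The live instrument, re-read: `FinCS ↔` «gauge `> c + 3` on the conjugation-stable cells». -/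
theorem finCS_iff_gauge : FinCS ↔
    ∀ (n c : ℕ), LowerRanks n → ∀ y : Fin n → ℂ, NearOpt n c y → ConjStable y → LinearIndependent ℚ y →
      (∃ P, IsCertificate n y P) → c + 3 < certGauge n y :=
  finCSAt_std_iff.symm.trans (finCSAt_iff_gauge stdGauge)

/-- **HOW THE ROUTE CLOSES AT A FINITE GAUGE** (the mechanism of `RootDecomp1H.closes`, laid bare): instrument and bridge at
the same gauge are the two sides `g < N(y)` and `N(y) ≤ g` of one inequality at a transverse conjugation-stable near-`c⋆`-optimal
first failure; so no such first failure exists. -/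
theorem no_transverse_firstFailure {g : ℕ → ℕ → ℕ} (hF : FinCSAt g) (hB : BridgeAt g) {n c : ℕ} (hlow : LowerRanks n)
    {y : Fin n → ℂ} (hopt : NearOpt n c y) (hcs : ConjStable y) (hce : CounterEx y) (hnh : ¬ InTowerHull y) : False := by
  have h1 := (finCSAt_iff_gauge g).1 hF n c hlow y hopt hcs hce.1 (exists_certificate_of_counterEx hce)
  have h2 := (bridgeAt_iff_gauge g).1 hB n c hlow y hopt hcs hce hnh
  omega

/-! ## 4. Span-optimal presentations (the first inline hypothesis, verbatim, from any presentation) -/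

/-- **From a presentation to a near-`c⋆`-optimal tuple of the same span**: minimise, over all tuples `y'` with
`span_ℚ y' = span_ℚ y`, the least size at which `y'` is presented (`Nat.find`). -/
theorem exists_nearOpt_of_presented {c₀ : ℕ} {y : Fin n → ℂ} (h : Presented n c₀ y) :
    ∃ (c : ℕ) (z : Fin n → ℂ), Submodule.span ℚ (Set.range z) = Submodule.span ℚ (Set.range y) ∧ NearOpt n c z := by
  classical
  have hex : ∃ c, ∃ z : Fin n → ℂ, Submodule.span ℚ (Set.range y) = Submodule.span ℚ (Set.range z) ∧ Presented n c z :=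
    ⟨c₀, y, rfl, h⟩
  obtain ⟨z, hzy, hz⟩ := Nat.find_spec hex
  refine ⟨Nat.find hex, z, hzy.symm, hz, fun c' hc' hy' => ?_⟩
  obtain ⟨y', hy'z, hy'⟩ := hy'
  exact Nat.find_min hex hc' ⟨y', hzy.trans hy'z, hy'⟩

/-- Same span ⇒ same `ℚ`-freeness, conjugation-stability and counterexample status (tree lemmas, collected). -/
theorem transport_of_span_eq {y z : Fin n → ℂ} (h : Submodule.span ℚ (Set.range z) = Submodule.span ℚ (Set.range y))
    (hli : LinearIndependent ℚ y) (hcs : ConjStable y) :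
    LinearIndependent ℚ z ∧ ConjStable z :=
  ⟨RootDecomp1HStarLocalisation.linearIndependent_of_span_eq h.symm hli,
    RootDecomp1HStarLocalisation.conjStable_of_span_eq h.symm hcs⟩

/-- The round-8 witness `W₃ = (a₀, √2 a₀, i a₀)` is presented at size `2` (its Khovanskii system `gW`). -/
theorem presented_W₃ : Presented 3 2 W₃ :=
  ⟨⟨gW ℚ, complexity_gW, aeval_gW, by
    rw [det_jacobian_gW]
    exact mul_ne_zero (mul_ne_zero (mul_ne_zero (by norm_num) Complex.I_ne_zero) (pow_ne_zero 2 a₀_ne_zero)) key_ne_zero⟩,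
    norm_W₃_le⟩

/-- **(ii)+ of the critic's ledger**: a tuple `W₃⋆` with `span_ℚ W₃⋆ = span_ℚ W₃` satisfying the FIRST INLINE HYPOTHESIS of
`BridgeTransverse` verbatim (near-`c⋆`-optimal at some `c ≤ 2`); by `transport_of_span_eq` and round 8 it is `ℚ`-free and
conjugation-stable, and it lies off the tower hull whenever `W₃` does (`InTowerHull` is a property of the span). -/
theorem exists_nearOpt_W₃ :
    ∃ (c : ℕ) (z : Fin 3 → ℂ), Submodule.span ℚ (Set.range z) = Submodule.span ℚ (Set.range W₃) ∧ NearOpt 3 c z :=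
  exists_nearOpt_of_presented presented_W₃

/-- `InTowerHull` is a property of the span. -/
theorem inTowerHull_of_span_le {m : ℕ} {y : Fin n → ℂ} {z : Fin m → ℂ}
    (h : Submodule.span ℚ (Set.range z) ≤ Submodule.span ℚ (Set.range y)) (hy : InTowerHull y) : InTowerHull z := by
  obtain ⟨N, b, hb, htow, hmem⟩ := hy
  refine ⟨N, b, hb, htow, fun j => ?_⟩
  have hz : z j ∈ Submodule.span ℚ (Set.range y) := h (Submodule.subset_span ⟨j, rfl⟩)
  exact (Submodule.span_le.2 (by rintro _ ⟨i, rfl⟩; exact hmem i)) hz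

/-! ## 5. A half-rung off the hull: `trdeg ℚ(W₄, e^{W₄}) ≥ 2` from Theorem 2.9 (a named fact discharged in tree) -/

/-- **THE RANK-4 CONFIGURATION** `W₄ = (a₀, √2·a₀, i·a₀, i√2·a₀)`. -/
def W₄ : Fin 4 → ℂ := ![(a₀ : ℂ), rt2 * a₀, I * a₀, I * rt2 * a₀]

/-- `W₄ 0 = a₀`. -/
@[simp] theorem W₄_zero : W₄ 0 = a₀ := rfl
/-- `W₄ 1 = √2·a₀`. -/
@[simp] theorem W₄_one : W₄ 1 = rt2 * a₀ := rfl
/-- `W₄ 2 = i·a₀`. -/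
@[simp] theorem W₄_two : W₄ 2 = I * a₀ := rfl
/-- `W₄ 3 = i·√2·a₀`. -/
@[simp] theorem W₄_three : W₄ 3 = I * rt2 * a₀ := rfl

/-- `a + b√2 = 0` with `a, b ∈ ℚ` forces `a = b = 0`. -/
theorem rat_sqrt_two {a b : ℚ} (h : (a : ℝ) + b * Real.sqrt 2 = 0) : a = 0 ∧ b = 0 := by
  have hb : b = 0 := by
    by_contra hb
    have hirr : Irrational ((b : ℝ) * Real.sqrt 2) := irrational_sqrt_two.ratCast_mul hb
    exact hirr.ne_rat (-a) (by push_cast; linarith)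
  refine ⟨?_, hb⟩
  have : (a : ℝ) = 0 := by rw [hb] at h; simpa using h
  exact_mod_cast this

/-- `1, √2, i, i√2` are linearly independent over `ℚ`. -/
theorem combo₄_eq_zero {q₀ q₁ q₂ q₃ : ℚ} (h : (q₀ : ℂ) + q₁ * rt2 + q₂ * I + q₃ * (I * rt2) = 0) :
    q₀ = 0 ∧ q₁ = 0 ∧ q₂ = 0 ∧ q₃ = 0 := by
  have hre := congrArg Complex.re h
  have him := congrArg Complex.im h
  simp [rt2] at hre him
  obtain ⟨h0, h1⟩ := rat_sqrt_two hre
  obtain ⟨h2, h3⟩ := rat_sqrt_two him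
  exact ⟨h0, h1, h2, h3⟩

/-- `W₄` is `ℚ`-free. -/
theorem linearIndependent_W₄ : LinearIndependent ℚ W₄ := by
  rw [Fintype.linearIndependent_iff]
  intro g hg
  have hsum : ((g 0 : ℂ) + g 1 * rt2 + g 2 * I + g 3 * (I * rt2)) * a₀ = 0 := by
    rw [Fin.sum_univ_four] at hg
    simp only [W₄_zero, W₄_one, W₄_two, W₄_three, Rat.smul_def] at hg
    linear_combination hg
  have h := combo₄_eq_zero ((mul_eq_zero.1 hsum).resolve_right a₀_ne_zero)
  intro i
  fin_cases i
  · exact h.1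
  · exact h.2.1
  · exact h.2.2.1
  · exact h.2.2.2

/-- `W₄` is conjugation-stable (`conj` fixes `a₀, √2 a₀` and negates `i a₀, i√2 a₀`). -/
theorem conjStable_W₄ : ConjStable W₄ := by
  intro j
  fin_cases j
  · have h : (starRingEnd ℂ) (W₄ 0) = W₄ 0 := by simp [Complex.conj_ofReal]
    rw [show ((fun i => i) ⟨0, by norm_num⟩ : Fin 4) = 0 from rfl, h]
    exact Submodule.subset_span ⟨0, rfl⟩
  · have h : (starRingEnd ℂ) (W₄ 1) = W₄ 1 := by simp [rt2, Complex.conj_ofReal]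
    rw [show ((fun i => i) ⟨1, by norm_num⟩ : Fin 4) = 1 from rfl, h]
    exact Submodule.subset_span ⟨1, rfl⟩
  · have h : (starRingEnd ℂ) (W₄ 2) = -W₄ 2 := by simp [Complex.conj_ofReal, Complex.conj_I]
    rw [show ((fun i => i) ⟨2, by norm_num⟩ : Fin 4) = 2 from rfl, h]
    exact Submodule.neg_mem _ (Submodule.subset_span ⟨2, rfl⟩)
  · have h : (starRingEnd ℂ) (W₄ 3) = -W₄ 3 := by simp [rt2, Complex.conj_ofReal, Complex.conj_I]
    rw [show ((fun i => i) ⟨3, by norm_num⟩ : Fin 4) = 3 from rfl, h]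
    exact Submodule.neg_mem _ (Submodule.subset_span ⟨3, rfl⟩)

/-- `span_ℚ W₃ ≤ span_ℚ W₄`. -/
theorem span_W₃_le_span_W₄ : Submodule.span ℚ (Set.range W₃) ≤ Submodule.span ℚ (Set.range W₄) := by
  rw [Submodule.span_le]
  rintro _ ⟨j, rfl⟩
  fin_cases j
  · exact Submodule.subset_span ⟨0, rfl⟩
  · exact Submodule.subset_span ⟨1, rfl⟩
  · exact Submodule.subset_span ⟨2, rfl⟩

/-- `W₄` lies off the tower hull whenever `W₃` does … -/
theorem not_inTowerHull_W₄ (h : ¬ InTowerHull W₃) : ¬ InTowerHull W₄ :=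
  fun h4 => h (inTowerHull_of_span_le span_W₃_le_span_W₄ h4)

/-- … in particular under `ProductSchanuel ∧ RelTowerSchanuel` (round 8). -/
theorem not_inTowerHull_W₄_of_structural (hPS : ProductSchanuel) (hRT : RelTowerSchanuel) : ¬ InTowerHull W₄ :=
  not_inTowerHull_W₄ (not_inTowerHull_W₃_of_structural hPS hRT)

/-- The grid: `x = (a₀, i a₀)`. -/
def gridX : Fin 2 → ℂ := ![(a₀ : ℂ), I * a₀]

/-- The grid: `y = (1, √2, i)`. -/
def gridY : Fin 3 → ℂ := ![1, rt2, I]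

/-- `gridX` is `ℚ`-free. -/
theorem linearIndependent_gridX : LinearIndependent ℚ gridX := by
  rw [Fintype.linearIndependent_iff]
  intro g hg
  have hsum : ((g 0 : ℂ) + 0 * rt2 + g 1 * I + 0 * (I * rt2)) * a₀ = 0 := by
    rw [Fin.sum_univ_two] at hg
    simp only [gridX, Matrix.cons_val_zero, Matrix.cons_val_one, Rat.smul_def] at hg
    linear_combination hg
  have h := combo₄_eq_zero (q₁ := 0) (q₃ := 0) (by exact_mod_cast (mul_eq_zero.1 hsum).resolve_right a₀_ne_zero)
  intro i
  fin_cases i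
  · exact h.1
  · exact h.2.2.1

/-- `gridY` is `ℚ`-free. -/
theorem linearIndependent_gridY : LinearIndependent ℚ gridY := by
  rw [Fintype.linearIndependent_iff]
  intro g hg
  have hsum : (g 0 : ℂ) + g 1 * rt2 + g 2 * I + 0 * (I * rt2) = 0 := by
    rw [Fin.sum_univ_three] at hg
    simp only [gridY, Matrix.cons_val_zero, Matrix.cons_val_one, Matrix.cons_val_two, Matrix.head_cons, Matrix.tail_cons,
      Rat.smul_def] at hg
    linear_combination hg
  have h := combo₄_eq_zero (q₃ := 0) (by exact_mod_cast hsum)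
  intro i
  fin_cases i
  · exact h.1
  · exact h.2.1
  · exact h.2.2.1

/-- The field of the configuration: `L₄ = ℚ(W₄, e^{W₄})`. -/
def L₄ : IntermediateField ℚ ℂ := IntermediateField.adjoin ℚ (range W₄ ∪ range (cexp ∘ W₄))

/-- the coordinates of `W₄` lie in `L₄ = ℚ(W₄, e^{W₄})`. -/
theorem W₄_mem_L₄ (j : Fin 4) : W₄ j ∈ L₄ := IntermediateField.subset_adjoin _ _ (Or.inl ⟨j, rfl⟩)

/-- the exponentials of `W₄` lie in `L₄`. -/
theorem exp_W₄_mem_L₄ (j : Fin 4) : cexp (W₄ j) ∈ L₄ := IntermediateField.subset_adjoin _ _ (Or.inr ⟨j, rfl⟩)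

/-- `a₀ ∈ L₄`. -/
theorem a₀_mem_L₄ : (a₀ : ℂ) ∈ L₄ := W₄_mem_L₄ 0

/-- `√2 ∈ L₄`. -/
theorem rt2_mem_L₄ : rt2 ∈ L₄ := by
  have h : rt2 = (rt2 * a₀) / a₀ := (mul_div_cancel_right₀ rt2 a₀_ne_zero).symm
  rw [h]
  exact div_mem (W₄_mem_L₄ 1) a₀_mem_L₄

/-- `i ∈ L₄`. -/
theorem I_mem_L₄ : I ∈ L₄ := by
  have h : I = (I * a₀) / a₀ := (mul_div_cancel_right₀ I a₀_ne_zero).symm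
  rw [h]
  exact div_mem (W₄_mem_L₄ 2) a₀_mem_L₄

/-- The grid field `ℚ(x, y, e^{xᵢyⱼ})` of `x = (a₀, i a₀)`, `y = (1, √2, i)` lies inside `ℚ(W₄, e^{W₄})`. -/
theorem gridField₂_le_L₄ : Literature.Barriers.Schanuel.gridField₂ gridX gridY ≤ L₄ := by
  rw [Literature.Barriers.Schanuel.gridField₂, IntermediateField.adjoin_le_iff]
  rintro z ((⟨i, rfl⟩ | ⟨j, rfl⟩) | ⟨⟨i, j⟩, rfl⟩)
  · fin_cases i
    · exact a₀_mem_L₄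
    · exact W₄_mem_L₄ 2
  · fin_cases j
    · exact one_mem _
    · exact rt2_mem_L₄
    · exact I_mem_L₄
  · fin_cases i <;> fin_cases j
    · show cexp ((a₀ : ℂ) * 1) ∈ L₄
      rw [mul_one]; exact exp_W₄_mem_L₄ 0
    · show cexp ((a₀ : ℂ) * rt2) ∈ L₄
      rw [mul_comm]; exact exp_W₄_mem_L₄ 1
    · show cexp ((a₀ : ℂ) * I) ∈ L₄
      rw [mul_comm]; exact exp_W₄_mem_L₄ 2
    · show cexp (I * (a₀ : ℂ) * 1) ∈ L₄
      rw [mul_one]; exact exp_W₄_mem_L₄ 2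
    · show cexp (I * (a₀ : ℂ) * rt2) ∈ L₄
      rw [show I * (a₀ : ℂ) * rt2 = I * rt2 * a₀ by ring]; exact exp_W₄_mem_L₄ 3
    · show cexp (I * (a₀ : ℂ) * I) ∈ L₄
      rw [show I * (a₀ : ℂ) * I = -(a₀ : ℂ) by rw [mul_comm, ← mul_assoc, Complex.I_mul_I]; ring, Complex.exp_neg]
      exact inv_mem (exp_W₄_mem_L₄ 0)

/-- **THE HALF-RUNG**: `trdeg ℚ(W₄, e^{W₄}) ≥ 2` — Theorem 2.9 of LNM 1752 Ch. 14 (the named fact `smallTrdeg_thm_2_9_pos`,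
discharged in tree by `Literature.Barriers.Schanuel.smallTrdeg_thm_2_9_pos_holds`) on the grid `(a₀, i a₀) × (1, √2, i)`,
`ℓ + d = 5 < 6 = dℓ`.  Schanuel predicts `4`. -/
theorem two_le_trdeg_W₄ (h29 : Literature.Barriers.Schanuel.smallTrdeg_thm_2_9_pos) : (2 : Cardinal) ≤ Algebra.trdeg ℚ ↥L₄ :=
  (h29.two_le_trdeg_gridField₂ gridX gridY linearIndependent_gridX linearIndependent_gridY
    (by norm_num)).trans (Literature.Barriers.Schanuel.trdeg_mono gridField₂_le_L₄)

/-- The same bound in the item's notation. -/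
theorem two_le_trdeg_W₄' (h29 : Literature.Barriers.Schanuel.smallTrdeg_thm_2_9_pos) :
    (2 : Cardinal) ≤ Algebra.trdeg ℚ ↥(IntermediateField.adjoin ℚ (range W₄ ∪ range (cexp ∘ W₄))) :=
  two_le_trdeg_W₄ h29

/-- **Every counterexample among `W₃, W₄` carries a finite certificate gauge** (§2 at the witnesses): if `W₄` is a counterexample
its gauge is attained — the residual at its cell asks `certGauge 4 W₄⋆ ≤ c⋆ + 3` for the span-optimal representative. -/
theorem certGauge_W₄_of_counterEx (h : CounterEx W₄) :
    ∃ P, (∀ i, psize (P i) ≤ certGauge 4 W₄) ∧ IsCertificate 4 W₄ P :=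
  certGauge_spec_of_counterEx h


end Summit.Schanuel.Schanuel.Theorems.RootDecomp1HGauge
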